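import Summits.HodgeConjecture.HodgeConjecture.Theorems.K2E1bU21DatumRelations     -- ★ αᵤ-4 (K2E4-p10 (g3)): `exists_datum` (+ ★ αᵤ-1∕1b∕2a∕3∕4a)
import Summits.HodgeConjecture.HodgeConjecture.Theorems.K2E1bDatumCubicScalar      -- ★ 8b-β part 1 p857081: `upqLieC_σOfRecord_single` (twist dictionary), `finSumFinEquiv_inl_zero∕…`
import Literature.RepresentationTheory.Kovacevic2021.SU21SubmoduleLattice          -- ★ `single_mem_of_mem_support`
import HarnessLib

/-!
# K2 ∕ E1b · 8b-αᵤ road FILE 5b, first half «THE MODEL INTERTWINER ON THE BASIS» (row αᵤ-5b): the module-side strings `(−f)^j (u n m)` of the datum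
# of a `(𝔤, K)`-module of `U(2,1)`, and the eight operators + the centre intertwined on Kovačević's basis

HCML Track B «K2-LIT», cell `hodgecm-mathlib`, crux H413 = stmt-HodgeConjecture-24833 (supports-only helper; closes nothing by itself).  Socket 8b-αᵤ
`sig_K2E1bModelOfRecordCohUnitary`; DEAL (D-αᵤ5b) K2E1b-plan (g4) → K2E4-p10 (g3) 2026-09-04T04:27:44Z (+ K2E1b-r01 (g4) pre-read 04:30:22Z).
THEOREMS ONLY (no `def`, no `sorry`, no instance declaration, no notation).  The head `exists_intertwiner_of_datum` (nine matrix units + injectivity) is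
the second half `Theorems/K2E1bU21ModelIntertwiner.lean` (split for the 400-line lint); here every statement is about an ARBITRARY linear `Φ : 𝒟.V →ₗ[ℂ] V`
with `Φ (𝒟.vec n m (j+1)) = (−f)^j (u n m)` (hypothesis `hΦ`; realised there by `Finsupp.linearCombination`, §1 `linearCombination_vec`).

## What is here

* §0 the `r`-side string `(−f)^j (u n m)`: torus weights `w + j(δ₁ − δ₀)` (★ αᵤ-3 `weight_upqLieC_single` along `f = E₁₀`), hence the three diagonal scalars
  `T₀ − T₁ ↦ n − 1 − 2j`, `T₁ − T₂ ↦ (m − n + 1 + 2j)∕2`, `T₀ + T₁ + T₂ ↦ e` (labels ★ `labelN∕M∕E`: `6w₀ = 2e+m+3n−3`, `6w₁ = 2e+m−3n+3`, `3w₂ = e−m`).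
* §1 `Φ := Finsupp.linearCombination` on the basis `u^k_{n,m} = 𝒟.vec n m k`; `Φ (𝒟.vec n m (j+1)) = (−f)^j (u n m)` for ALL `n m j` (both sides vanish off range:
  ★ `vec_of_neg`, and past the string by ★ `exists_datum` (iv)).
* §2 the eight operators (★ `Ha_vec … Yb_vec` on the datum side; ★ `u21_string_kovacevic` and ★ `exists_datum` (v) on the module side) and the three diagonal
  units with the twist `+δ_{ij}(e∕3)` (★ `upqLieC_σOfRecord_single`).
Sources: [Kovacevic2021] §3 Def. 1, Thm. 1–2, Remark 2; [KnappVogan1995] §IV.1; [BorelWallach2000] II §4.1.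
HONEST LABEL: a helper of the 8b-αᵤ road (file 5b); it closes nothing by itself; HC_CM is proved only modulo the 7 printed citations (2 remaining named inputs:
hLiu418 = stmt-HodgeConjecture-24832, h413 = stmt-HodgeConjecture-24833) until rung 0 closes.
-/

-- Mathlib idiom (as in every ★ Kovačević ∕ αᵤ file): commutator bracket on `Module.End ℂ V` and on matrices.
attribute [local instance 100] LieRing.ofAssociativeRing

set_option autoImplicit false
set_option linter.dupNamespace false

noncomputable section

namespace Summit.HodgeConjecture.HodgeConjecture.Cruxes.H413.K2E1bU21ModelIntertwinerBasis

open Literature.RepresentationTheory Literature.RepresentationTheory.KonnoKonno2007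
open Literature.RepresentationTheory.Kovacevic2021 Literature.RepresentationTheory.Kovacevic2021.SU21Datum
open Literature.NumberTheory.Automorphic
open Summit.HodgeConjecture.HodgeConjecture.Cruxes.H413.F0P3bLocalAPacketsDefs
open Summit.HodgeConjecture.HodgeConjecture.Cruxes.H413.K2E1bU21Weights
open Summit.HodgeConjecture.HodgeConjecture.Cruxes.H413.K2E1bU21KTypeStrings
open Summit.HodgeConjecture.HodgeConjecture.Cruxes.H413.K2E1bU21PActionNormalForm
open Summit.HodgeConjecture.HodgeConjecture.Cruxes.H413.K2E1bCarriersOfRecord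
open Summit.HodgeConjecture.HodgeConjecture.Cruxes.H413.K2E1bDatumCubicScalar

variable {V : Type*} [AddCommGroup V] [Module ℂ V]
  {ρK : Representation ℂ G21.maximalCompact V} (ρ𝔤 : G21.lie →ₗ⁅ℝ⁆ Module.End ℂ V)

/-! ## §0 The module-side string `(−f)^j (u n m)`: torus weights and the three diagonal scalars -/

/-- **Torus weights along the string**: if `x` has torus weight `w`, then `(−f)^j x` has weight `w + j(δ₁ − δ₀)` (`f = E₁₀`, ★ `weight_upqLieC_single`).
[cite: Kovacevic2021, §3 Def. 1] [cite: KnappVogan1995, Prop. 1.18] -/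
theorem weight_negf_pow {w : Fin 2 ⊕ Fin 1 → ℤ} {x : V} (hx : ∀ i, upqLieC ρ𝔤 (Matrix.single i i (1 : ℂ)) x = (w i : ℂ) • x) (j : ℕ)
    (i : Fin 2 ⊕ Fin 1) :
    upqLieC ρ𝔤 (Matrix.single i i (1 : ℂ)) (((-u21f ρ𝔤) ^ j) x) =
      ((w + (j : ℤ) • (Pi.single (Sum.inl 1) 1 - Pi.single (Sum.inl 0) 1) : Fin 2 ⊕ Fin 1 → ℤ) i : ℂ) • ((-u21f ρ𝔤) ^ j) x := by
  have hfx : ∀ y : V, u21f ρ𝔤 y = upqLieC ρ𝔤 (Matrix.single (Sum.inl 1) (Sum.inl 0) (1 : ℂ)) y := fun y => by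
    rw [u21f_eq_upqLieC_single]
  induction j generalizing i with
  | zero => simp only [pow_zero, Module.End.one_apply, Nat.cast_zero, zero_smul, add_zero, hx]
  | succ j ih =>
    rw [pow_succ', Module.End.mul_apply, LinearMap.neg_apply, map_neg, hfx, weight_upqLieC_single ρ𝔤 ih (Sum.inl 1) (Sum.inl 0) i,
      smul_neg]
    congr 2
    simp only [Pi.add_apply, Pi.sub_apply, Pi.smul_apply, smul_eq_mul, Nat.cast_succ]
    ring

/-! ## §1 The intertwiner on the basis, and the three diagonal scalars of the module-side string -/

section Datum

variable {e : ℤ} {𝒟 : SU21Datum} {u : ℤ → ℤ → V}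
  (hi : ∀ n m : ℤ, u n m ≠ 0 → ∃ w, labelN w = n ∧ labelM w = m ∧ labelE w = e ∧ u n m ∈ hwSpace ρ𝔤 w)
  (hS : ∀ n m : ℤ, (n, m) ∈ 𝒟.S ↔ u n m ≠ 0)
  (hstr : ∀ n m : ℤ, u n m ≠ 0 → (u21f ρ𝔤 ^ n.toNat) (u n m) = 0 ∧ ∀ k < n.toNat, (u21f ρ𝔤 ^ k) (u n m) ≠ 0)

include hstr in
/-- Past the string the module-side vectors vanish: `(−f)^j (u n m) = 0` for `j ≥ n`. [cite: Kovacevic2021, §3 Def. 1] -/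
theorem negf_pow_apply_eq_zero_of_le {n m : ℤ} {j : ℕ} (hj : n ≤ j) : ((-u21f ρ𝔤) ^ j) (u n m) = 0 := by
  by_cases h0 : u n m = 0
  · rw [h0, map_zero]
  · obtain ⟨hn, -⟩ := hstr n m h0
    have hsgn : ∀ (k : ℕ) (y : V), ((-u21f ρ𝔤) ^ k) y = ((-1 : ℂ) ^ k) • (u21f ρ𝔤 ^ k) y := by
      intro k y
      induction k with
      | zero => simp only [pow_zero, Module.End.one_apply, one_smul]
      | succ k ih =>
        rw [pow_succ', Module.End.mul_apply, ih, LinearMap.neg_apply, map_smul, pow_succ' (u21f ρ𝔤) k, Module.End.mul_apply,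
          pow_succ (-1 : ℂ) k, mul_neg_one, neg_smul]
    obtain ⟨d, hd⟩ : ∃ d, j = d + n.toNat := ⟨j - n.toNat, by omega⟩
    rw [hd, pow_add, Module.End.mul_apply, hsgn n.toNat, hn, smul_zero, map_zero]

include hS hstr in
/-- **The intertwiner on the basis, uniformly**: for `Φ := Finsupp.linearCombination ℂ (t ↦ (−f)^{k−1} (u n m))`,
`Φ (𝒟.vec n m (j+1)) = (−f)^j (u n m)` for ALL `n m j` (off the admissible labels both sides vanish). [cite: Kovacevic2021, §3 Def. 1] -/
theorem linearCombination_vec (n m : ℤ) (j : ℕ) :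
    Finsupp.linearCombination ℂ (fun t : 𝒟.Idx => ((-u21f ρ𝔤) ^ (t.1.2.2 - 1).toNat) (u t.1.1 t.1.2.1)) (𝒟.vec n m ((j : ℤ) + 1)) =
      ((-u21f ρ𝔤) ^ j) (u n m) := by
  by_cases h : (n, m) ∈ 𝒟.S ∧ (1 : ℤ) ≤ (j : ℤ) + 1 ∧ (j : ℤ) + 1 ≤ n
  · rw [vec_of_pos n m _ h, Finsupp.linearCombination_single, one_smul]
    simp only [add_sub_cancel_right, Int.toNat_natCast]
  · rw [vec_of_neg n m _ h, map_zero]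
    by_cases h0 : u n m = 0
    · rw [h0, map_zero]
    · have hSn : (n, m) ∈ 𝒟.S := (hS n m).2 h0
      have hle : ¬ ((j : ℤ) + 1 ≤ n) := fun hle => h ⟨hSn, by omega, hle⟩
      exact (negf_pow_apply_eq_zero_of_le ρ𝔤 hstr (by omega)).symm

include hi in
/-- **The three diagonal scalars on the module-side string** `y = (−f)^j (u n m)`: `(T₀ − T₁) y = (n − 1 − 2j) y`, `(T₁ − T₂) y = ((m − n + 1 + 2j)∕2) y`,
`(T₀ + T₁ + T₂) y = e y` (`T_i = ρ_ℂ(E_ii)`; torus weights §0 and the labels `(n, m, e)` of the highest weight). [cite: Kovacevic2021, §3 Def. 1] -/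
theorem diag_negf_pow (n m : ℤ) (j : ℕ) :
    (upqLieC ρ𝔤 (Matrix.single (Sum.inl 0) (Sum.inl 0) (1 : ℂ)) (((-u21f ρ𝔤) ^ j) (u n m)) =
        (((2 * e + m + 3 * n - 3 : ℤ) : ℂ) / 6 - j) • ((-u21f ρ𝔤) ^ j) (u n m)) ∧
      (upqLieC ρ𝔤 (Matrix.single (Sum.inl 1) (Sum.inl 1) (1 : ℂ)) (((-u21f ρ𝔤) ^ j) (u n m)) =
        (((2 * e + m - 3 * n + 3 : ℤ) : ℂ) / 6 + j) • ((-u21f ρ𝔤) ^ j) (u n m)) ∧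
      (upqLieC ρ𝔤 (Matrix.single (Sum.inr 0) (Sum.inr 0) (1 : ℂ)) (((-u21f ρ𝔤) ^ j) (u n m)) =
        (((e - m : ℤ) : ℂ) / 3) • ((-u21f ρ𝔤) ^ j) (u n m)) := by
  by_cases h0 : u n m = 0
  · simp only [h0, map_zero, smul_zero, and_self]
  obtain ⟨w, h1, h2, h3, hw⟩ := hi n m h0
  have hx := (mem_wtSpace_iff ρ𝔤 w _).1 ((mem_hwSpace_iff ρ𝔤 w _).1 hw).1
  have hW := weight_negf_pow ρ𝔤 hx j
  unfold labelN at h1; unfold labelM at h2; unfold labelE at h3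
  refine ⟨?_, ?_, ?_⟩
  · rw [hW]; congr 1
    have key : (6 : ℂ) * (w (Sum.inl 0) : ℂ) = 2 * (e : ℂ) + m + 3 * n - 3 := by
      rw [← h1, ← h2, ← h3]; push_cast; ring
    simp only [Pi.add_apply, Pi.sub_apply, Pi.smul_apply, Pi.single_apply, smul_eq_mul]
    simp only [Sum.inl.injEq, if_true, if_false, zero_ne_one, zero_sub]
    push_cast
    linear_combination (1 / 6 : ℂ) * key
  · rw [hW]; congr 1
    have key : (6 : ℂ) * (w (Sum.inl 1) : ℂ) = 2 * (e : ℂ) + m - 3 * n + 3 := by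
      rw [← h1, ← h2, ← h3]; push_cast; ring
    simp only [Pi.add_apply, Pi.sub_apply, Pi.smul_apply, Pi.single_apply, smul_eq_mul]
    simp only [Sum.inl.injEq, if_true, if_false, one_ne_zero, mul_one, sub_zero]
    push_cast
    linear_combination (1 / 6 : ℂ) * key
  · rw [hW]; congr 1
    have key : (3 : ℂ) * (w (Sum.inr 0) : ℂ) = (e : ℂ) - m := by
      rw [← h2, ← h3]; push_cast; ring
    simp only [Pi.add_apply, Pi.sub_apply, Pi.smul_apply, Pi.single_apply, smul_eq_mul]
    simp only [reduceCtorEq, if_false, mul_zero, sub_zero, add_zero]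
    push_cast
    linear_combination (1 / 3 : ℂ) * key

/-! ## §2 The eight operators and the centre, on the basis -/

variable (hT : ∀ (n m : ℤ) (k : ℕ),
    u21E ρ𝔤 0 (((-u21f ρ𝔤) ^ k) (u n m)) =
        (((n : ℂ) - k) * 𝒟.A n m) • ((-u21f ρ𝔤) ^ k) (u (n + 1) (m + 3)) + ((k : ℂ) * 𝒟.C n m) • ((-u21f ρ𝔤) ^ (k - 1)) (u (n - 1) (m + 3)) ∧
      u21E ρ𝔤 1 (((-u21f ρ𝔤) ^ k) (u n m)) =
        (-𝒟.A n m) • ((-u21f ρ𝔤) ^ (k + 1)) (u (n + 1) (m + 3)) + 𝒟.C n m • ((-u21f ρ𝔤) ^ k) (u (n - 1) (m + 3)) ∧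
      u21F ρ𝔤 1 (((-u21f ρ𝔤) ^ k) (u n m)) =
        (((n : ℂ) - k) * 𝒟.B n m) • ((-u21f ρ𝔤) ^ k) (u (n + 1) (m - 3)) - ((k : ℂ) * 𝒟.D n m) • ((-u21f ρ𝔤) ^ (k - 1)) (u (n - 1) (m - 3)) ∧
      u21F ρ𝔤 0 (((-u21f ρ𝔤) ^ k) (u n m)) =
        𝒟.B n m • ((-u21f ρ𝔤) ^ (k + 1)) (u (n + 1) (m - 3)) + 𝒟.D n m • ((-u21f ρ𝔤) ^ k) (u (n - 1) (m - 3)))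
  {Φ : 𝒟.V →ₗ[ℂ] V} (hΦ : ∀ (n m : ℤ) (j : ℕ), Φ (𝒟.vec n m ((j : ℤ) + 1)) = ((-u21f ρ𝔤) ^ j) (u n m))

/-- basis labels have `k = j + 1`, `j : ℕ` [folklore] -/
private theorem exists_eq_succ {k : ℤ} (hk : 1 ≤ k) : ∃ j : ℕ, k = (j : ℤ) + 1 := ⟨(k - 1).toNat, by omega⟩

include hi in
/-- `h (u n m) = (n − 1) u n m` and `e (u n m) = 0` (labels of the highest weight; trivially if `u n m = 0`). [cite: Kovacevic2021, §3 Def. 1] -/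
theorem hw_of_family (n m : ℤ) : u21h ρ𝔤 (u n m) = ((n : ℂ) - 1) • u n m ∧ u21e ρ𝔤 (u n m) = 0 := by
  by_cases h0 : u n m = 0
  · rw [h0, map_zero, map_zero, smul_zero]; exact ⟨rfl, rfl⟩
  · obtain ⟨w, h1, -, -, hw⟩ := hi n m h0
    obtain ⟨hv, hev⟩ := (mem_hwSpace_iff ρ𝔤 w _).1 hw
    refine ⟨?_, hev⟩
    rw [u21h_apply_of_mem_wtSpace' ρ𝔤 hv, h1, Int.cast_sub, Int.cast_one]

include hi hΦ in
/-- `Φ ∘ X_α = e ∘ Φ` (★ `Xa_vec` vs ★ `u21e_apply_neg_u21f_pow_succ_apply`). [cite: Kovacevic2021, §3 Def. 1] -/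
theorem comp_Xa : Φ ∘ₗ 𝒟.Xa = u21e ρ𝔤 ∘ₗ Φ := by
  refine ext_vec fun n m k _ hk _ => ?_
  obtain ⟨j, rfl⟩ := exists_eq_succ hk
  obtain ⟨hh, he⟩ := hw_of_family ρ𝔤 hi n m
  rw [LinearMap.comp_apply, LinearMap.comp_apply, Xa_vec, map_smul, hΦ]
  rcases j with _ | j
  · simp [he]
  · rw [show ((j + 1 : ℕ) : ℤ) + 1 - 1 = (j : ℤ) + 1 by push_cast; ring, hΦ, u21e_apply_neg_u21f_pow_succ_apply ρ𝔤 hh he j, ← neg_smul]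
    congr 1; push_cast; ring

include hΦ in
/-- `Φ ∘ Y_α = f ∘ Φ` (★ `Ya_vec` vs ★ `u21f_apply_neg_u21f_pow_apply`). [cite: Kovacevic2021, §3 Def. 1] -/
theorem comp_Ya : Φ ∘ₗ 𝒟.Ya = u21f ρ𝔤 ∘ₗ Φ := by
  refine ext_vec fun n m k _ hk _ => ?_
  obtain ⟨j, rfl⟩ := exists_eq_succ hk
  rw [LinearMap.comp_apply, LinearMap.comp_apply, Ya_vec n m hk, map_neg, show (j : ℤ) + 1 + 1 = ((j + 1 : ℕ) : ℤ) + 1 by push_cast; ring,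
    hΦ, hΦ, u21f_apply_neg_u21f_pow_apply]

include hT hΦ in
/-- `Φ ∘ X_{α+β} = E₀ ∘ Φ` (★ `Xab_vec` vs (T1)). [cite: Kovacevic2021, §3 Thm. 1] -/
theorem comp_Xab : Φ ∘ₗ 𝒟.Xab = u21E ρ𝔤 0 ∘ₗ Φ := by
  refine ext_vec fun n m k _ hk _ => ?_
  obtain ⟨j, rfl⟩ := exists_eq_succ hk
  rw [LinearMap.comp_apply, LinearMap.comp_apply, Xab_vec, map_add, map_smul, map_smul, hΦ, hΦ, (hT n m j).1]
  rcases j with _ | j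
  · simp
  · rw [show ((j + 1 : ℕ) : ℤ) + 1 - 1 = (j : ℤ) + 1 by push_cast; ring, hΦ, Nat.add_sub_cancel]
    congr 1 <;> (push_cast; ring)

include hT hΦ in
/-- `Φ ∘ X_β = E₁ ∘ Φ` (★ `Xb_vec` vs (T2)). [cite: Kovacevic2021, §3 Thm. 1] -/
theorem comp_Xb : Φ ∘ₗ 𝒟.Xb = u21E ρ𝔤 1 ∘ₗ Φ := by
  refine ext_vec fun n m k _ hk _ => ?_
  obtain ⟨j, rfl⟩ := exists_eq_succ hk
  rw [LinearMap.comp_apply, LinearMap.comp_apply, Xb_vec n m hk, map_add, map_smul, map_smul,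
    show (j : ℤ) + 1 + 1 = ((j + 1 : ℕ) : ℤ) + 1 by push_cast; ring, hΦ, hΦ, hΦ, (hT n m j).2.1]

include hT hΦ in
/-- `Φ ∘ Y_{α+β} = F₀ ∘ Φ` (★ `Yab_vec` vs (T4)). [cite: Kovacevic2021, §3 Thm. 1] -/
theorem comp_Yab : Φ ∘ₗ 𝒟.Yab = u21F ρ𝔤 0 ∘ₗ Φ := by
  refine ext_vec fun n m k _ hk _ => ?_
  obtain ⟨j, rfl⟩ := exists_eq_succ hk
  rw [LinearMap.comp_apply, LinearMap.comp_apply, Yab_vec n m hk, map_add, map_smul, map_smul,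
    show (j : ℤ) + 1 + 1 = ((j + 1 : ℕ) : ℤ) + 1 by push_cast; ring, hΦ, hΦ, hΦ, (hT n m j).2.2.2]

include hT hΦ in
/-- `Φ ∘ Y_β = F₁ ∘ Φ` (★ `Yb_vec` vs (T3)). [cite: Kovacevic2021, §3 Thm. 1] -/
theorem comp_Yb : Φ ∘ₗ 𝒟.Yb = u21F ρ𝔤 1 ∘ₗ Φ := by
  refine ext_vec fun n m k _ hk _ => ?_
  obtain ⟨j, rfl⟩ := exists_eq_succ hk
  rw [LinearMap.comp_apply, LinearMap.comp_apply, Yb_vec, map_add, map_smul, map_smul, hΦ, hΦ, (hT n m j).2.2.1]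
  rcases j with _ | j
  · simp
  · rw [show ((j + 1 : ℕ) : ℤ) + 1 - 1 = (j : ℤ) + 1 by push_cast; ring, hΦ, Nat.add_sub_cancel, neg_smul, ← sub_eq_add_neg]
    congr 1 <;> (push_cast; ring)

include hi hΦ in
/-- `Φ ∘ H_α = (T₀ − T₁) ∘ Φ` (★ `Ha_vec` vs §1 `diag_negf_pow`). [cite: Kovacevic2021, §3 Def. 1] -/
theorem comp_Ha : Φ ∘ₗ 𝒟.Ha = (upqLieC ρ𝔤 (Matrix.single (Sum.inl 0) (Sum.inl 0) (1 : ℂ)) -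
    upqLieC ρ𝔤 (Matrix.single (Sum.inl 1) (Sum.inl 1) (1 : ℂ))) ∘ₗ Φ := by
  refine ext_vec fun n m k _ hk _ => ?_
  obtain ⟨j, rfl⟩ := exists_eq_succ hk
  obtain ⟨h0, h1, -⟩ := diag_negf_pow ρ𝔤 hi (e := e) n m j
  rw [LinearMap.comp_apply, LinearMap.comp_apply, Ha_vec, map_smul, hΦ, LinearMap.sub_apply, h0, h1, ← sub_smul]
  congr 1; push_cast; ring

include hi hΦ in
/-- `Φ ∘ H_β = (T₁ − T₂) ∘ Φ` (★ `Hb_vec` vs §1 `diag_negf_pow`). [cite: Kovacevic2021, §3 Def. 1] -/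
theorem comp_Hb : Φ ∘ₗ 𝒟.Hb = (upqLieC ρ𝔤 (Matrix.single (Sum.inl 1) (Sum.inl 1) (1 : ℂ)) -
    upqLieC ρ𝔤 (Matrix.single (Sum.inr 0) (Sum.inr 0) (1 : ℂ))) ∘ₗ Φ := by
  refine ext_vec fun n m k _ hk _ => ?_
  obtain ⟨j, rfl⟩ := exists_eq_succ hk
  obtain ⟨-, h1, h2⟩ := diag_negf_pow ρ𝔤 hi (e := e) n m j
  rw [LinearMap.comp_apply, LinearMap.comp_apply, Hb_vec, map_smul, hΦ, LinearMap.sub_apply, h1, h2, ← sub_smul]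
  congr 1; push_cast; ring

include hi hΦ in
/-- **The centre acts by `e` on the range**: `(T₀ + T₁ + T₂) (Φ v) = e · Φ v` (§1 `diag_negf_pow` on the basis). [cite: Rogawski1990, §12.3 p. 177] -/
theorem centre_apply (v : 𝒟.V) :
    upqLieC ρ𝔤 (Matrix.single (Sum.inl 0) (Sum.inl 0) (1 : ℂ)) (Φ v) + upqLieC ρ𝔤 (Matrix.single (Sum.inl 1) (Sum.inl 1) (1 : ℂ)) (Φ v) +
      upqLieC ρ𝔤 (Matrix.single (Sum.inr 0) (Sum.inr 0) (1 : ℂ)) (Φ v) = (e : ℂ) • Φ v := by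
  have key : (upqLieC ρ𝔤 (Matrix.single (Sum.inl 0) (Sum.inl 0) (1 : ℂ)) + upqLieC ρ𝔤 (Matrix.single (Sum.inl 1) (Sum.inl 1) (1 : ℂ)) +
      upqLieC ρ𝔤 (Matrix.single (Sum.inr 0) (Sum.inr 0) (1 : ℂ))) ∘ₗ Φ = ((e : ℂ) • LinearMap.id) ∘ₗ Φ := by
    refine ext_vec fun n m k _ hk _ => ?_
    obtain ⟨j, rfl⟩ := exists_eq_succ hk
    obtain ⟨h0, h1, h2⟩ := diag_negf_pow ρ𝔤 hi (e := e) n m j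
    rw [LinearMap.comp_apply, LinearMap.comp_apply, hΦ, LinearMap.add_apply, LinearMap.add_apply, h0, h1, h2, ← add_smul, ← add_smul,
      LinearMap.smul_apply, LinearMap.id_apply]
    congr 1; push_cast; ring
  simpa only [LinearMap.comp_apply, LinearMap.add_apply, LinearMap.smul_apply, LinearMap.id_apply] using LinearMap.congr_fun key v

end Datum

end Summit.HodgeConjecture.HodgeConjecture.Cruxes.H413.K2E1bU21ModelIntertwinerBasis

end
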